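import Literature.AlgebraicGeometry.Motives.ProjectiveBundleOfQuotientTrivialisationOfFrame
import Literature.AlgebraicGeometry.Motives.GrassmannianSchemeRelativeDimension
import Literature.AlgebraicGeometry.Motives.GrassmannianRepresentable
import Literature.AlgebraicGeometry.Modules.RankOneCocycle
import Literature.AlgebraicGeometry.Resolution.ExceptionalDivisorSmoothProjective
import Literature.AlgebraicGeometry.Morphisms.ProjectiveMorphismComposition
import Literature.AlgebraicGeometry.HodgeTheory.ProjectiveBundleOfGloballyGeneratedQuotient
import Mathlib.LinearAlgebra.ExteriorPower.Basis
import HarnessLib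

/-!
# `P(G) → X` is smooth of relative dimension `r` and (given geometric irreducibility of `Gr₁`) a smooth projective `(n + r)`-fold

Topic `AlgebraicGeometry/Motives`; namespace `Literature.AlgebraicGeometry.Motives.Grassmannian.ProjBundle`. THEOREMS ONLY (no definition,
no instance, no notation, no named fact, no `sorry`).

[Hartshorne1977, II §7 Prop. 7.10–7.11, III Prop. 10.1]: `P(ℰ) → X` is projective, Zariski-locally `U × ℙʳ → U`, hence smooth of
relative dimension `r` with geometrically irreducible fibres; over a smooth projective geometrically irreducible `X` the total space is
a smooth projective variety of dimension `dim X + r`. For the tree's incidence model `proj : P(G) → X` of `φ : 𝒪^J ↠ G` with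
`G` of rank `r + 1` (★ `Motives/ProjectiveBundleOfQuotient`), the local trivialisations ★ `exists_trivialisationIso`
(`P(G)|_U ≅ U × Gr₁(ℤ^{J'})`, `#J' = r + 1`, over the affine opens of a frame system of `G`) TRANSFER every property of morphisms which
is Zariski-local on the target and stable under base change from `Gr₁(ℤ^{J'}) → Spec ℤ` to `proj` (`of_grassmannian`): smoothness of
relative dimension `r` (★ `smoothOfRelativeDimension_terminal_from`, [GortzWedhorn2020, Cor. 8.15]) UNCONDITIONALLY
(`smoothOfRelativeDimension_proj`), and geometric irreducibility GIVEN that of `Gr₁(ℤ^{J'}) → Spec ℤ` (`geometricallyIrreducible_proj`).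
Assembly (`isSmoothProjective_total`, `projectiveBundleOfGloballyGeneratedQuotient_of_geometricallyIrreducible`): the named fact
★ `HodgeTheory/ProjectiveBundleOfGloballyGeneratedQuotient` — hence ★ `ProjectiveBundleTautologicalQuotient` and the splitting principle
`FlagBundleSplitting` (★ `HodgeTheory/ProjectiveBundleTautologicalQuotientOfGloballyGenerated`) — follows from the single remaining input
`GeometricallyIrreducible (terminal.from (grassmannianScheme (J' →₀ ℤ) 1))` for finite `J'` (the fibres `Gr₁(K^{J'}) = ℙ(K^{J'})` are
irreducible; [GortzWedhorn2020, (8.4)–(8.6)]), taken here as a HYPOTHESIS.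

## References
* [Hartshorne1977] R. Hartshorne, *Algebraic Geometry* (1977), II §7 Prop. 7.10, 7.11; III Prop. 10.1.
* [GortzWedhorn2020] U. Görtz, T. Wedhorn, *Algebraic Geometry I*, 2nd ed. (2020), Cor. 8.15, (8.4)–(8.6), (13.8).
* [StacksProject] The Stacks project, Tags 0366, 01V4, 089T.
-/

set_option autoImplicit false

noncomputable section

open CategoryTheory CategoryTheory.Limits Opposite TopologicalSpace AlgebraicGeometry
open Literature.AlgebraicGeometry.Modules Literature.AlgebraicGeometry.Morphisms Literature.AlgebraicGeometry.Resolution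

namespace Literature.AlgebraicGeometry.Motives.Grassmannian

namespace ProjBundle

/-! ## §1 Transfer of target-local, base-change-stable properties from `Gr₁ → Spec ℤ` to `proj` -/

section Transfer

variable {X : Scheme.{0}} (M : Type) [AddCommGroup M] {J : Type} [Fintype J] [DecidableEq J] (b : Module.Basis J ℤ M)
  [(grassmannianSheaf M 1).obj.IsRepresentable] {G : X.Modules} (φ : freeModule X J ⟶ G) [Epi φ] {r : ℕ}
  (hG : HasRank G (r + 1))

include hG in
/-- **TRANSFER**: a property of morphisms which is Zariski-local on the target and stable under base change, and which holds for
`Gr₁(ℤ^{J'}) → Spec ℤ` whenever `#J' = r + 1`, holds for `proj : P(G) → X` (`G` of rank `r + 1`): on the affine opens of a frame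
system of `G`, `proj` is `U × Gr₁(ℤ^{J'}) → U` up to isomorphism (★ `exists_trivialisationIso`), a base change of `Gr₁ → Spec ℤ`.
[cite: Hartshorne1977, II §7 Prop. 7.11] [cite: GortzWedhorn2020, (13.8)] -/
theorem of_grassmannian (P : MorphismProperty Scheme.{0}) [IsZariskiLocalAtTarget P] [P.IsStableUnderBaseChange]
    (hP : ∀ (J' : Type) [Fintype J'] [DecidableEq J'] [(grassmannianSheaf (J' →₀ ℤ) 1).obj.IsRepresentable],
      Fintype.card J' = r + 1 → P (terminal.from (grassmannianScheme (J' →₀ ℤ) 1))) :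
    P (proj M b φ) := by
  classical
  obtain ⟨F, hF⟩ := exists_frameSystem_of_hasRank hG
  have hGl : IsFiniteLocallyFree G := HasRank.isFiniteLocallyFree' hG
  -- an affine open `V x ∋ x` inside the frame open `F.U x`
  have hcov : ∀ x : X, ∃ V : X.Opens, x ∈ V ∧ IsAffineOpen V ∧ V ≤ F.U x := fun x => by
    obtain ⟨_, ⟨V, hV, rfl⟩, hxV, hVle⟩ := X.isBasis_affineOpens.exists_subset_of_mem_open (F.mem x) (F.U x).2
    exact ⟨V, hxV, hV, hVle⟩
  choose V hxV hV hVU using hcov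
  refine IsZariskiLocalAtTarget.of_iSup_eq_top (P := P) V
    (top_le_iff.mp fun x _ => Opens.mem_iSup.mpr ⟨x, hxV x⟩) fun x => ?_
  haveI : Fintype (F.I x) := Fintype.ofEquiv _ (F.enum x).symm
  haveI := isRepresentable_grassmannianSheaf_of_basis 1 (F.I x →₀ ℤ) (Finsupp.basisSingleOne (R := ℤ) (ι := F.I x))
  obtain ⟨t, ht⟩ := exists_trivialisationIso M b φ hGl (F.I x →₀ ℤ) (Finsupp.basisSingleOne (R := ℤ) (ι := F.I x)) (hV x)
    (SheafOfModules.restrictTrivialisation (R := X.ringCatSheaf) (homOfLE (hVU x)) (F.frame x))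
  rw [← ht, P.cancel_left_of_respectsIso]
  have hcard : Fintype.card (F.I x) = r + 1 := by
    rw [Fintype.card_congr (F.enum x), Fintype.card_fin, hF x]
  exact MorphismProperty.IsStableUnderBaseChange.of_isPullback (IsPullback.of_hasBinaryProduct' _ _).flip
    (hP (F.I x) hcard)

/-- `Gr₁(ℤ^{J'}) → Spec ℤ` is smooth of relative dimension `#J' - 1` (★ `smoothOfRelativeDimension_terminal_from` with
`k (n - k) = 1 · (#J' - 1)`). [cite: GortzWedhorn2020, Cor. 8.15 (p. 216)] -/
theorem smoothOfRelativeDimension_terminal_from_grassmannian_one (J' : Type) [Fintype J']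
    [(grassmannianSheaf (J' →₀ ℤ) 1).obj.IsRepresentable] (hJ' : Fintype.card J' = r + 1) :
    SmoothOfRelativeDimension r (terminal.from (grassmannianScheme (J' →₀ ℤ) 1)) := by
  have h := smoothOfRelativeDimension_terminal_from (k := 1) (M := J' →₀ ℤ)
  rwa [Module.finrank_eq_card_basis (Finsupp.basisSingleOne (R := ℤ) (ι := J')), hJ', Nat.add_sub_cancel, one_mul] at h

include hG in
/-- **`proj : P(G) → X` IS SMOOTH OF RELATIVE DIMENSION `r`** for `G` of rank `r + 1`. [cite: Hartshorne1977, III Prop. 10.1]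
[cite: GortzWedhorn2020, Cor. 8.15 (p. 216)] -/
theorem smoothOfRelativeDimension_proj : SmoothOfRelativeDimension r (proj M b φ) :=
  haveI : MorphismProperty.IsStableUnderBaseChange (@SmoothOfRelativeDimension r) :=
    smoothOfRelativeDimension_isStableUnderBaseChange r
  of_grassmannian M b φ hG (@SmoothOfRelativeDimension r)
    fun J' _ _ _ hJ' => smoothOfRelativeDimension_terminal_from_grassmannian_one J' hJ'

include hG in
/-- **`proj : P(G) → X` is geometrically irreducible**, GIVEN that `Gr₁(ℤ^{J'}) → Spec ℤ` is (for `#J' = r + 1`).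
[cite: Hartshorne1977, II §7 Prop. 7.11] [cite: StacksProject, Tag 0366] -/
theorem geometricallyIrreducible_proj
    (hGr : ∀ (J' : Type) [Fintype J'] [DecidableEq J'] [(grassmannianSheaf (J' →₀ ℤ) 1).obj.IsRepresentable],
      Fintype.card J' = r + 1 → GeometricallyIrreducible (terminal.from (grassmannianScheme (J' →₀ ℤ) 1))) :
    GeometricallyIrreducible (proj M b φ) :=
  haveI : IsZariskiLocalAtTarget @GeometricallyIrreducible :=
    GeometricallyIrreducible.eq_geometrically ▸ inferInstance
  of_grassmannian M b φ hG @GeometricallyIrreducible hGr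

end Transfer

/-! ## §2 Assembly: `P(G)` is a smooth projective `(n + r)`-fold; the named fact `ProjectiveBundleOfGloballyGeneratedQuotient` -/

section Assembly

variable {X : SchemeOver ℂ} {n : ℕ} (hX : IsSmoothProjective n X) (M : Type) [AddCommGroup M] [Module.Finite ℤ M] [Module.Free ℤ M]
  {J : Type} [Fintype J] [DecidableEq J] (b : Module.Basis J ℤ M) [(grassmannianSheaf M 1).obj.IsRepresentable]
  [(grassmannianSheaf (⋀[ℤ]^1 M) 1).obj.IsRepresentable] {G : X.left.Modules} (φ : freeModule X.left J ⟶ G) [Epi φ] {r : ℕ}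
  (hG : HasRank G (r + 1))

include hX hG in
/-- **`P(G)` IS A SMOOTH PROJECTIVE `(n + r)`-FOLD** over a smooth projective `n`-fold `X` (given geometric irreducibility of
`Gr₁ → Spec ℤ`): smooth of relative dimension `r + n` (composition), projective (★ `isProjective_proj`, composition, ★
`isProjective_hom_iff_isProjectiveOver`), geometrically irreducible (★ `geometricallyIrreducible_comp_of_smooth`).
[cite: Hartshorne1977, II §7 Prop. 7.10 and III Prop. 10.1] [cite: StacksProject, Tags 01V4 and 0366] -/
theorem isSmoothProjective_total
    (hGr : ∀ (J' : Type) [Fintype J'] [DecidableEq J'] [(grassmannianSheaf (J' →₀ ℤ) 1).obj.IsRepresentable],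
      Fintype.card J' = r + 1 → GeometricallyIrreducible (terminal.from (grassmannianScheme (J' →₀ ℤ) 1))) :
    IsSmoothProjective (n + r) (Over.mk (proj M b φ ≫ X.hom) : SchemeOver ℂ) := by
  haveI h1 : SmoothOfRelativeDimension r (proj M b φ) := smoothOfRelativeDimension_proj M b φ hG
  haveI h2 : GeometricallyIrreducible (proj M b φ) := geometricallyIrreducible_proj M b φ hG hGr
  haveI := hX.smoothOfRelativeDimension
  have hsm : SmoothOfRelativeDimension (n + r) (proj M b φ ≫ X.hom) := by
    rw [Nat.add_comm]
    infer_instance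
  have hproj : IsProjective (proj M b φ ≫ X.hom) :=
    (isProjective_proj M b φ).comp ((isProjective_hom_iff_isProjectiveOver X).mpr hX.isProjectiveOver)
  exact ⟨hsm, (isProjective_hom_iff_isProjectiveOver (Over.mk (proj M b φ ≫ X.hom) : SchemeOver ℂ)).mp hproj,
    IsZariskiProjectiveBundle.geometricallyIrreducible_comp_of_smooth (r := r) (proj M b φ) hX⟩

end Assembly

/-- **THE NAMED FACT `ProjectiveBundleOfGloballyGeneratedQuotient` FROM GEOMETRIC IRREDUCIBILITY OF `Gr₁ → Spec ℤ`**: for every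
finite `J'`, `GeometricallyIrreducible (Gr₁(ℤ^{J'}) → Spec ℤ)` ⟹ the one-level projective bundle of a globally generated bundle on a
smooth projective complex variety exists as stated (total space `P(G)`, projection `proj`, tautological sequence ★
`exists_shortExact_of_hasRank`). [cite: Hartshorne1977, II §7 Prop. 7.10–7.12] [cite: GortzWedhorn2020, (13.8) and Cor. 8.15] -/
theorem projectiveBundleOfGloballyGeneratedQuotient_of_geometricallyIrreducible
    (hGr : ∀ (J' : Type) [Fintype J'] [DecidableEq J'] [(grassmannianSheaf (J' →₀ ℤ) 1).obj.IsRepresentable],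
      GeometricallyIrreducible (terminal.from (grassmannianScheme (J' →₀ ℤ) 1))) :
    HodgeTheory.ProjectiveBundleOfGloballyGeneratedQuotient := by
  intro n X hX J _ G r φ hφ hG
  classical
  haveI : Fintype J := Fintype.ofFinite J
  haveI := isRepresentable_grassmannianSheaf_of_basis 1 (J →₀ ℤ) (Finsupp.basisSingleOne (R := ℤ) (ι := J))
  haveI : Module.Free ℤ (⋀[ℤ]^1 (J →₀ ℤ)) := exteriorPower.instFree ℤ 1
  haveI := isRepresentable_grassmannianSheaf (⋀[ℤ]^1 (J →₀ ℤ)) 1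
  have hE : Epi (φ : freeModule X.left J ⟶ G) := hφ
  have hP := @isSmoothProjective_total X n hX (J →₀ ℤ) _ _ _ J _ _ (Finsupp.basisSingleOne (R := ℤ) (ι := J)) _ _ G φ
    hE r hG fun J' _ _ _ _ => hGr J'
  haveI : GeometricallyIrreducible (proj (J →₀ ℤ) (Finsupp.basisSingleOne (R := ℤ) (ι := J)) φ) :=
    @geometricallyIrreducible_proj X.left (J →₀ ℤ) _ J _ _ (Finsupp.basisSingleOne (R := ℤ) (ι := J)) _ G φ hE r hG
      fun J' _ _ _ _ => hGr J'
  have hsurj : Surjective (proj (J →₀ ℤ) (Finsupp.basisSingleOne (R := ℤ) (ι := J)) φ) := inferInstance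
  obtain ⟨S, hS, h1, h3, h2⟩ := @exists_shortExact_of_hasRank X.left (J →₀ ℤ) _ J
    (Finsupp.basisSingleOne (R := ℤ) (ι := J)) _ G φ _ hE r hG
  exact ⟨Over.mk (proj (J →₀ ℤ) Finsupp.basisSingleOne φ ≫ X.hom), Over.homMk (proj (J →₀ ℤ) Finsupp.basisSingleOne φ) rfl,
    hP, hsurj, S, hS, h1, h3, h2⟩

/-- **THE NAMED FACT FROM GEOMETRIC IRREDUCIBILITY OF `Gr₁(ℤ^{J'}) → Spec ℤ` FOR NONEMPTY `J'`** — the usable form of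
`projectiveBundleOfGloballyGeneratedQuotient_of_geometricallyIrreducible` (whose hypothesis, quantifying over ALL finite `J'`, includes
the empty index type, for which `Gr₁(0) = ∅` and the hypothesis fails): only `#J' = r + 1 ≥ 1` is ever used.
[cite: Hartshorne1977, II §7 Prop. 7.10–7.12] [cite: GortzWedhorn2020, (13.8) and Cor. 8.15] -/
theorem projectiveBundleOfGloballyGeneratedQuotient_of_geometricallyIrreducible_of_nonempty
    (hGr : ∀ (J' : Type) [Fintype J'] [DecidableEq J'] [(grassmannianSheaf (J' →₀ ℤ) 1).obj.IsRepresentable],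
      Nonempty J' → GeometricallyIrreducible (terminal.from (grassmannianScheme (J' →₀ ℤ) 1))) :
    HodgeTheory.ProjectiveBundleOfGloballyGeneratedQuotient := by
  intro n X hX J _ G r φ hφ hG
  classical
  haveI : Fintype J := Fintype.ofFinite J
  haveI := isRepresentable_grassmannianSheaf_of_basis 1 (J →₀ ℤ) (Finsupp.basisSingleOne (R := ℤ) (ι := J))
  haveI : Module.Free ℤ (⋀[ℤ]^1 (J →₀ ℤ)) := exteriorPower.instFree ℤ 1
  haveI := isRepresentable_grassmannianSheaf (⋀[ℤ]^1 (J →₀ ℤ)) 1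
  have hE : Epi (φ : freeModule X.left J ⟶ G) := hφ
  have hGr' : ∀ (J' : Type) [Fintype J'] [DecidableEq J'] [(grassmannianSheaf (J' →₀ ℤ) 1).obj.IsRepresentable],
      Fintype.card J' = r + 1 → GeometricallyIrreducible (terminal.from (grassmannianScheme (J' →₀ ℤ) 1)) :=
    fun J' _ _ _ hJ' => hGr J' (Fintype.card_pos_iff.mp (by omega))
  have hP := @isSmoothProjective_total X n hX (J →₀ ℤ) _ _ _ J _ _ (Finsupp.basisSingleOne (R := ℤ) (ι := J)) _ _ G φ
    hE r hG hGr'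
  haveI : GeometricallyIrreducible (proj (J →₀ ℤ) (Finsupp.basisSingleOne (R := ℤ) (ι := J)) φ) :=
    @geometricallyIrreducible_proj X.left (J →₀ ℤ) _ J _ _ (Finsupp.basisSingleOne (R := ℤ) (ι := J)) _ G φ hE r hG hGr'
  have hsurj : Surjective (proj (J →₀ ℤ) (Finsupp.basisSingleOne (R := ℤ) (ι := J)) φ) := inferInstance
  obtain ⟨S, hS, h1, h3, h2⟩ := @exists_shortExact_of_hasRank X.left (J →₀ ℤ) _ J
    (Finsupp.basisSingleOne (R := ℤ) (ι := J)) _ G φ _ hE r hG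
  exact ⟨Over.mk (proj (J →₀ ℤ) Finsupp.basisSingleOne φ ≫ X.hom), Over.homMk (proj (J →₀ ℤ) Finsupp.basisSingleOne φ) rfl,
    hP, hsurj, S, hS, h1, h3, h2⟩

end ProjBundle

end Literature.AlgebraicGeometry.Motives.Grassmannian

end
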